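import Summits.CriticalPhenomena.PercolationContinuityZ3.Theorems.PercNearOneGluingNoHeavyLowerTailCILHyperedgeReduction
import HarnessLib

/-!
# `NoHeavyLowerTail` (stmt-CriticalPhenomena-4575) — star expansion of an ARBITRARY reachability functional, and of glued lightness

Support file (prover `prim-hp-3`, hull-port line; `--supports stmt-CriticalPhenomena-4575`).  No definitions, no named facts, no sorries.
This is the first bookkeeping lemma of the Lean roadmap for the OVERTAKING BOUND `F ≥ max_x (D_x − Ω_x)` of the two-sided kernel
(crux notes run/shared/lean/prim/prim-hp-3/HULLPORT-REF-gen2.md §9, PROOF-OVERTAKING-BOUND.md §1): the DOUBLE star expansion needs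
`Hyperedge.lightness_star_expansion` not only for the plain lightness event but for the "glued lightness" events `g_S` that the first
expansion produces.  Both are instances of ONE statement:

**Theorem (`Hyperedge.reachFunctional_star_expansion`).**  Let `o ∉ P` be a vertex whose positive-weight pairs end in `P`, and let the
event `E = {ω | Φ(Reach_ω)}` be given by ANY functional `Φ` of the reachability relation that only evaluates it at pairs of vertices `≠ o`.
Then `μ(E) = Σ_{B ⊆ P} μ(σ_B) · μ{ω | Φ(Reach^B_{ω∖o})}`, where `σ_B` is the star event "the open pairs at `o` are exactly those to `B`",
`ω∖o = ω ∩ {e | o ∉ e}`, and `Reach^B_ξ(a,b) :⟺ Reach_ξ(a,b) ∨ (a ~_ξ B ∧ B ~_ξ b)` (joined off `o`, or both joined off `o` to the block `B`).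
Proof: `KNPreFKG.real_eq_sum_inter_starEvent` + `Hyperedge.reachable_iff_star` pointwise + `measureReal_starEvent_inter_avoid`, exactly as in
`lightness_star_expansion`, with the functional abstracted.

* `Hyperedge.gluedLightness_star_expansion` — the instance needed by the roadmap: the lightness of a relay `x` measured with a relay block `S`
  glued (`|{z ∈ A : x ↔ z ∨ (x ↔ S ∧ S ↔ z)}| ≤ j`, the event `g_S` of `lightness_star_expansion`) expands over the star of a second
  observer `o ∉ A ∪ S` into the two-block events `|{z : R^B(x,z) ∨ (∃ s∈S, R^B(s,x)) ∧ ∃ s'∈S, R^B(s',z)}| ≤ j` with `R^B = Reach^B_{ω∖o}`.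
-/

noncomputable section

namespace Summit.CriticalPhenomena.PercolationContinuityZ3.Theorems

open MeasureTheory Set Literature.Probability.LatticeModels Literature.Probability.Percolation
open scoped Classical BigOperators

variable {n : ℕ}

namespace Hyperedge

open CutObserver KNPreFKG

/-- **Star expansion of a reachability functional.**  For `o ∉ P` whose positive-weight pairs end in `P` and a functional `Φ` of the
reachability relation that ignores pairs involving `o`:
`μ{ω | Φ(Reach_ω)} = Σ_{B ⊆ P} μ(σ_B) · μ{ω | Φ(Reach^B_{ω∖o})}`, `Reach^B_ξ(a,b) = Reach_ξ(a,b) ∨ (a ~_ξ B ∧ B ~_ξ b)`. [folklore] -/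
theorem reachFunctional_star_expansion (u : Sym2 (Fin n) → unitInterval) (o : Fin n) (P : Finset (Fin n))
    (hoP : o ∉ P) (hobs : ∀ y, y ≠ o → y ∉ P → u s(o, y) = 0)
    (Φ : (Fin n → Fin n → Prop) → Prop)
    (hΦ : ∀ R R' : Fin n → Fin n → Prop, (∀ a b, a ≠ o → b ≠ o → (R a b ↔ R' a b)) → (Φ R ↔ Φ R')) :
    (prodBernoulli u).real {ω : BondConfig (Fin n) | Φ fun a b => (openGraph ω).Reachable a b} =
      ∑ B ∈ P.powerset, (prodBernoulli u).real (starEvent o (↑B : Set (Fin n))) *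
        (prodBernoulli u).real {ω : BondConfig (Fin n) |
          Φ fun a b => (openGraph (ω ∩ {e | o ∉ e})).Reachable a b ∨
            ((∃ c ∈ B, (openGraph (ω ∩ {e | o ∉ e})).Reachable c a) ∧
              ∃ c' ∈ B, (openGraph (ω ∩ {e | o ∉ e})).Reachable c' b)} := by
  set μ := prodBernoulli u with hμ
  set E := {ω : BondConfig (Fin n) | Φ fun a b => (openGraph ω).Reachable a b} with hE
  set g : Finset (Fin n) → BondConfig (Fin n) → Prop := fun B ξ =>
    Φ fun a b => (openGraph ξ).Reachable a b ∨
      ((∃ c ∈ B, (openGraph ξ).Reachable c a) ∧ ∃ c' ∈ B, (openGraph ξ).Reachable c' b) with hg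
  rw [real_eq_sum_inter_starEvent u P o hoP hobs E]
  refine Finset.sum_congr rfl fun B hB => ?_
  have hBP : B ⊆ P := Finset.mem_powerset.1 hB
  have hBo : ∀ y ∈ B, y ≠ o := fun y hy h => hoP (h ▸ hBP hy)
  have hEq : E ∩ starEvent o (↑B : Set (Fin n)) = starEvent o (↑B : Set (Fin n)) ∩ {ω | g B (ω ∩ {e | o ∉ e})} := by
    ext ω
    simp only [hE, mem_inter_iff, mem_setOf_eq]
    constructor
    · rintro ⟨h, hω⟩
      refine ⟨hω, ?_⟩
      have key := hΦ (fun a b => (openGraph ω).Reachable a b)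
        (fun a b => (openGraph (ω ∩ {e | o ∉ e})).Reachable a b ∨
          ((∃ c ∈ B, (openGraph (ω ∩ {e | o ∉ e})).Reachable c a) ∧
            ∃ c' ∈ B, (openGraph (ω ∩ {e | o ∉ e})).Reachable c' b))
        (fun a b hao hbo => reachable_iff_star hω hBo hao hbo)
      simp only [hg]
      exact key.1 h
    · rintro ⟨hω, h⟩
      refine ⟨?_, hω⟩
      have key := hΦ (fun a b => (openGraph ω).Reachable a b)
        (fun a b => (openGraph (ω ∩ {e | o ∉ e})).Reachable a b ∨
          ((∃ c ∈ B, (openGraph (ω ∩ {e | o ∉ e})).Reachable c a) ∧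
            ∃ c' ∈ B, (openGraph (ω ∩ {e | o ∉ e})).Reachable c' b))
        (fun a b hao hbo => reachable_iff_star hω hBo hao hbo)
      simp only [hg] at h
      exact key.2 h
  rw [hEq, measureReal_starEvent_inter_avoid u o ↑B (g B)]

/-- **Star expansion of a glued lightness.**  For `o ∉ A` whose positive-weight pairs end in `P` (`o ∉ P`), a relay `x ∈ A` and a relay block
`S ⊆ A` (so `o ∉ S`): the event "at most `j` relays are joined to `x`, or to `S` while `x` is joined to `S`" (the `g_S` of
`lightness_star_expansion`) expands over the star of `o` into the corresponding two-block events. [folklore] -/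
theorem gluedLightness_star_expansion (u : Sym2 (Fin n) → unitInterval) (A : Finset (Fin n)) (o x : Fin n)
    (P S : Finset (Fin n)) (j : ℕ) (hoA : o ∉ A) (hxA : x ∈ A) (hSA : S ⊆ A) (hoP : o ∉ P)
    (hobs : ∀ y, y ≠ o → y ∉ P → u s(o, y) = 0) :
    (prodBernoulli u).real {ω : BondConfig (Fin n) |
        (A.filter fun z => (openGraph ω).Reachable x z ∨
          ((∃ s ∈ S, (openGraph ω).Reachable s x) ∧ ∃ s' ∈ S, (openGraph ω).Reachable s' z)).card ≤ j} =
      ∑ B ∈ P.powerset, (prodBernoulli u).real (starEvent o (↑B : Set (Fin n))) *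
        (prodBernoulli u).real {ω : BondConfig (Fin n) |
          (A.filter fun z =>
            ((openGraph (ω ∩ {e | o ∉ e})).Reachable x z ∨
              ((∃ c ∈ B, (openGraph (ω ∩ {e | o ∉ e})).Reachable c x) ∧
                ∃ c' ∈ B, (openGraph (ω ∩ {e | o ∉ e})).Reachable c' z)) ∨
            ((∃ s ∈ S, (openGraph (ω ∩ {e | o ∉ e})).Reachable s x ∨
                ((∃ c ∈ B, (openGraph (ω ∩ {e | o ∉ e})).Reachable c s) ∧
                  ∃ c' ∈ B, (openGraph (ω ∩ {e | o ∉ e})).Reachable c' x)) ∧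
              ∃ s' ∈ S, (openGraph (ω ∩ {e | o ∉ e})).Reachable s' z ∨
                ((∃ c ∈ B, (openGraph (ω ∩ {e | o ∉ e})).Reachable c s') ∧
                  ∃ c' ∈ B, (openGraph (ω ∩ {e | o ∉ e})).Reachable c' z))).card ≤ j} := by
  -- the glued-lightness functional only evaluates the relation at pairs of vertices of `A ∪ S ∪ {x}`, none of which is `o`
  have hxo : x ≠ o := fun h => hoA (h ▸ hxA)
  have hSo : ∀ s ∈ S, s ≠ o := fun s hs h => hoA (h ▸ hSA hs)
  have hAo : ∀ z ∈ A, z ≠ o := fun z hz h => hoA (h ▸ hz)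
  have key := reachFunctional_star_expansion u o P hoP hobs
    (fun R => (A.filter fun z => R x z ∨ ((∃ s ∈ S, R s x) ∧ ∃ s' ∈ S, R s' z)).card ≤ j)
    (by
      intro R R' hRR'
      have hset : (A.filter fun z => R x z ∨ ((∃ s ∈ S, R s x) ∧ ∃ s' ∈ S, R s' z)) =
          (A.filter fun z => R' x z ∨ ((∃ s ∈ S, R' s x) ∧ ∃ s' ∈ S, R' s' z)) := by
        refine Finset.filter_congr fun z hz => ?_
        rw [hRR' x z hxo (hAo z hz)]
        have h1 : (∃ s ∈ S, R s x) ↔ ∃ s ∈ S, R' s x :=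
          ⟨fun ⟨s, hs, h⟩ => ⟨s, hs, (hRR' s x (hSo s hs) hxo).1 h⟩,
            fun ⟨s, hs, h⟩ => ⟨s, hs, (hRR' s x (hSo s hs) hxo).2 h⟩⟩
        have h2 : (∃ s' ∈ S, R s' z) ↔ ∃ s' ∈ S, R' s' z :=
          ⟨fun ⟨s, hs, h⟩ => ⟨s, hs, (hRR' s z (hSo s hs) (hAo z hz)).1 h⟩,
            fun ⟨s, hs, h⟩ => ⟨s, hs, (hRR' s z (hSo s hs) (hAo z hz)).2 h⟩⟩
        rw [h1, h2]
      rw [hset])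
  beta_reduce at key
  convert key

end Hyperedge

end Summit.CriticalPhenomena.PercolationContinuityZ3.Theorems
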